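import Mathlib
import Literature.NumberTheory.EllipticCurves.AnalyticRank
import Literature.NumberTheory.EllipticCurves.GlobalMinimalModel
import HarnessLib

/-!
# ExistsAnalyticRankOneOddHeegnerCurve

Topic `Literature/Uncategorized`. Named literature fact(s) relocated by the gate from `Summits/BirchSwinnertonDyer/BirchSwinnertonDyer/Theorems/ShiftedKolyvaginAtInertTwoOddManinCMInertTwo/Negative/OddManinFalseOfRankOne.lean`
(accept-time relocation of `[cite]`d propositions written inline in a Summits proposal; human ruling 2026-08-15).
Sources: Cremona1997.

* `Literature.Uncategorized.ExistsAnalyticRankOneOddHeegnerCurve`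
-/

namespace Literature.Uncategorized

open WeierstrassCurve

/-- `H`: some globally minimal elliptic curve over `ℚ` with one of the five odd-Heegner
`j`-invariants (`D = −11, −19, −43, −67, −163`, the CM classes with `2` inert) has analytic rank `1`.
True in print (Cremona `121b1`, `361a1`, `1849a1`, `4489a1`, `26569a1` have `r_an = 1`), not
constructible in the tree (no kernel evaluation of `L'(E,1)`).
[cite: Cremona1997, Table 1 (curves 121B1, 361A1)] [topic: NumberTheory/EllipticCurves] -/
def ExistsAnalyticRankOneOddHeegnerCurve : Prop :=
  ∃ (W : WeierstrassCurve ℚ) (_ : W.IsElliptic) (_ : W.IsGloballyMinimal),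
    (W.j = -32768 ∨ W.j = -884736 ∨ W.j = -884736000 ∨ W.j = -147197952000 ∨
      W.j = -262537412640768000) ∧ W.analyticRank = 1

end Literature.Uncategorized
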